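import Summits.BirchSwinnertonDyer.BirchSwinnertonDyer.Theorems.ByReductionTypeAtTwoOrdKatoHalfAtTwoIsoColemanAssembly
import Summits.BirchSwinnertonDyer.BirchSwinnertonDyer.Theorems.ByReductionTypeAtTwoOrdKatoHalfAtTwoIsoZetaColemanMuIotaDoor
import Summits.BirchSwinnertonDyer.Rank1Residual.GaloisImage.IsogenySurjTransport
import HarnessLib

/-!
# Route ByReductionTypeAtTwo, crux `OrdKatoHalfAtTwoIso` (stmt-BirchSwinnertonDyer-19573), child B7′
# (stmt-BirchSwinnertonDyer-23921 `OrdKatoMuPartOptimalAtTwo`): the span-free Coleman `μ`-doors RE-KEYED — a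
# `θ`-SEMILINEAR column map `τ : P →ₛₗ[θ] X(E/ℚ_∞)` (`θ` ANY ring automorphism of `Λ`; print: `θ = ι`) — and B7′ BY NAME
# from ONE such package AT THE OPTIMAL MEMBER, uniformly in the image (theorems only)

Seat `cruxlead-stmt-BirchSwinnertonDyer-19573-w2` GEN 4 (prover WIDTH under the LEAD lineage `cruxlead-19573`; HOME
`run/shared/lean/pub/bsd-2adic/`; `--supports` stmt-BirchSwinnertonDyer-23921; pen RC-397 (2) / RC-400 (ii): «type the Coleman
half-class package at 2, ι-aware exactly as w3's θ-doors»). HONEST FRAMING (cell bsd-2adic): BSD is not proved by any of this;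
neither the crux nor B7′ is proved here; THEOREMS ONLY — the beyond-print input (the Coleman half-class package) is written INLINE as
a displayed hypothesis; every door is CONDITIONAL on it. The sequel `…OrdKatoHalfAtTwoIsoColemanHalfClassDefs.lean` displays the
package as ONE definition and re-states these doors by name.

WHY THIS FILE. GEN 3's assembly (p696823 `…ColemanAssembly`) reduces B7′ to four PRINT facts + two span-free Coleman `μ`-packages
with a `Λ`-LINEAR column map `τ : P → X`. The honest column map is `ι`-SEMILINEAR: Kato's Poitou–Tate map sends the `γ`-pinned
local Iwasawa cohomology (natural `Λ`-structure, `T = conj_γ − 1`) to the tree's Pontryagin dual `D.X` (PRECOMPOSITION structure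
`(T·x)(s) = x((conj_γ − 1)s)`), and the local Tate pairing is Galois-equivariant, `⟨(γ−1)u, s⟩ = ⟨u, (γ⁻¹−1)s⟩` — pen RC-373 (1) /
RC-383 «R-b»: key with `τ : P →ₛₗ[θ] D.X`, `θ : Λ ≃+* Λ` ANY ring automorphism (`θ = 1` the filed reading, `θ = ι =
IwasawaAlgebra.involEquiv 2` print); w3 did this for the zeta package (p690167 `…ZetaColemanMuIotaDoor`, p691807). This file does
it for the SPAN-FREE package that B7′ consumes, and nothing is lost: `μ` and the local length at `(2)` are blind to the keying
(`(2)` is `θ`-fixed; `TwoAdicKatoDeterminant.lengthAt_eq_of_semilinear_ringEquiv_of_asIdeal_eq_augIdealP`, p688071).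

* §2 `mu_le_mu_of_unitMultiple_of_exact_semilinear_of_finite_fineSelmer_pTorsion` — **the `μ`-door WITH SLACK, semilinear**:
  ideal `P ⊆ Λ`, `M ⊆ P`, `τ : P →ₛₗ[θ] X` killing `M`, `π : X ↠ X₀` exact after `τ`, `s·G ∈ M` (`s ∉ (2)`, `G ≠ 0`),
  `Sel₀(E/ℚ_∞)[2]` finite ⇒ `μ(X) ≤ μ(G)`; `mu_eq_zero_…_semilinear_…` — the `G ∉ (2)` case, `μ(X) = 0`.
* §3 `katoMuPartAtTwo_of_colemanPackageSemilinear_of_finite_fineSelmer_of_integralRatio` — `X5.O1.KatoMuPartAtTwo W′` at ONE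
  curve, ANY image, from the semilinear package for all data of `W′` + «`Sel₀(W′/ℚ_∞)[2]` finite» + «`0 ≤ ord₂ ϖ`»;
  `…_irr` — the `E[2]`-irreducible form without `ϖ` (analytic `μ₂ = 0`, p642753).
* §4 `not_hasSurjectiveModNGaloisRep_two_of_isIsogenous` — «`ρ̄_{W,2}` NOT onto» is a property of the `ℚ`-isogeny class
  (irreducible class: odd-degree transport `GaloisImage.surj_iff_of_isIsogenous_of_irr`; reducible class: GEN 3's
  `not_hasSurjectiveModNGaloisRep_two_of_isIsogenous_of_not_irreducible`) — GEN 3's «optional transport»; hence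
  `conjATwo_notSurjective_isogenous` — statement (A₂) at EVERY isogenous member of a not-onto curve from Lim@2 + Ferrero–Washington.
* §5 **`katoMuPartOff514_of_print_of_colemanPackageSemilinear_optimal`** / `ordKatoMuPartOptimalAtTwo_…` — B7′ = child 23921 BY
  NAME ⟸ PRINT {Abbes–Ullmo, modularity, Lim 2017 Thm 3.5 at `2`, Ferrero–Washington} + ONE displayed binder: the semilinear
  span-free Coleman package at every lattice-optimal member of every non-CM good-ordinary class with `ρ̄₂` not onto — NO
  image split (GEN 3 needed two binders: `C₃` at the curve, reducible at the optimal member).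

What this is NOT: the package is NOT proved (memo tier: on `0 < Δ` — the whole `C₃` part, the open reducible classes — its
classes are Kato's HALF classes, F-27a / p691215; MEMO-7 (1.1)(h) reaches the same `μ`-inequality through the relaxed-at-`∞` dual
with GENUINE classes; both beyond print at `2`); B7′ and the crux stay OPEN. References: [Kato2004Asterisque] 12.6, (14.9.3), 16.6,
17.11, §17.13; [MazurTateTeitelbaum1986Invent] §I.17; [GreenbergLNM1716] §1, p. 170; [Washington1997] §13.2; [BourbakiAC5to7] VII §4.4;
[AbbesUllmo1996]; [EdixhovenManin1991]; [Lim2017FineSelmer]; [FerreroWashington1979]; [Serre1972] §4; MEMO-7; RC-373/383/397.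
-/

set_option autoImplicit false
set_option linter.dupNamespace false

noncomputable section

open scoped Classical MatrixGroups ModularForm NumberField
open CongruenceSubgroup WeierstrassCurve Field IsDedekindDomain NumberField
open Literature.NumberTheory.GaloisRepresentations
open Literature.NumberTheory.GaloisCohomology
open Literature.NumberTheory.EllipticCurves Literature.NumberTheory.EllipticCurves.ModularForms
open Literature.NumberTheory.EllipticCurves.Kato2004
  Literature.NumberTheory.EllipticCurves.Kato2004.EulerSystemValues
open Literature.NumberTheory.EllipticCurves.Rank1Residual
open Literature.NumberTheory.EllipticCurves.Greenberg1999
open Literature.NumberTheory.IwasawaTheory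
open Summit.BirchSwinnertonDyer.BirchSwinnertonDyer.Theorems.Rank1ResidualX1Defs
  Summit.BirchSwinnertonDyer.BirchSwinnertonDyer.Rank1Residual
  Summit.BirchSwinnertonDyer.BirchSwinnertonDyer.Rank1Residual.CoreAssembly
open Summit.BirchSwinnertonDyer.Rank1Residual Summit.BirchSwinnertonDyer.Rank1Residual.X5
  Summit.BirchSwinnertonDyer.Rank1Residual.X1.MuLambda
open Summit.BirchSwinnertonDyer.BirchSwinnertonDyer.Theorems.OrdKatoOptimalAtTwo
  Summit.BirchSwinnertonDyer.BirchSwinnertonDyer.Theorems.OrdKatoIntAtTwo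
open Summit.BirchSwinnertonDyer.BirchSwinnertonDyer.Theses.ByReductionTypeAtTwo

namespace Summit.BirchSwinnertonDyer.BirchSwinnertonDyer.Theorems.SteinbergFibreAtTwo

/-! ## §1 Local length at `(2)` along a `θ`-semilinear map, with slack -/

section Semilinear

variable {p : ℕ} [Fact p.Prime]
  {A : Type*} [AddCommGroup A] [Module (IwasawaAlgebra p) A]
  {X : Type*} [AddCommGroup X] [Module (IwasawaAlgebra p) X]

/-- **The range of a `θ`-semilinear map has local length at `(p)` at most that of the source**, for ANY ring
automorphism `θ` of `Λ = ℤ_p⟦T⟧`: `f` induces a `θ`-semilinear additive bijection `A ⧸ ker f ≃ K` onto its range `K` (a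
`Λ`-submodule), local lengths agree along it at the `θ`-FIXED point `(p)`
(`TwoAdicKatoDeterminant.lengthAt_eq_of_semilinear_ringEquiv_of_asIdeal_eq_augIdealP`), and `length (A ⧸ ker f) ≤ length A`.
The `= 0` case is w3's `lengthAt_eq_zero_of_range_semilinear` (p690167). [cite: BourbakiAC5to7, Ch. VII §4.4] [cite: Washington1997, §13.2] -/
theorem lengthAt_le_of_range_semilinear (θ : IwasawaAlgebra p ≃+* IwasawaAlgebra p)
    (f : A →ₛₗ[(θ : IwasawaAlgebra p →+* IwasawaAlgebra p)] X) (K : Submodule (IwasawaAlgebra p) X)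
    (hK : ∀ x, x ∈ K ↔ x ∈ Set.range f) (𝔓 : PrimeSpectrum (IwasawaAlgebra p))
    (h𝔓 : 𝔓.asIdeal = IwasawaAlgebra.augIdealP p) :
    Module.lengthAt (IwasawaAlgebra p) K 𝔓 ≤ Module.lengthAt (IwasawaAlgebra p) A 𝔓 := by
  -- `A ⧸ ker f → K`, `θ`-semilinear, bijective
  let g : (A ⧸ LinearMap.ker f) →ₛₗ[(θ : IwasawaAlgebra p →+* IwasawaAlgebra p)] X :=
    (LinearMap.ker f).liftQ f le_rfl
  have hg_inj : Function.Injective g := by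
    rw [← LinearMap.ker_eq_bot]
    exact Submodule.ker_liftQ_eq_bot _ _ _ le_rfl
  have hg_mem : ∀ q, g q ∈ K := by
    intro q
    obtain ⟨a, rfl⟩ := Submodule.mkQ_surjective (LinearMap.ker f) q
    exact (hK _).2 ⟨a, (Submodule.liftQ_apply (LinearMap.ker f) f a).symm⟩
  let g' : (A ⧸ LinearMap.ker f) →+ K := g.toAddMonoidHom.codRestrict K.toAddSubgroup hg_mem
  have hg' : Function.Bijective g' := by
    refine ⟨fun x y h ↦ hg_inj (congrArg Subtype.val h), ?_⟩
    rintro ⟨x, hx⟩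
    obtain ⟨a, rfl⟩ := (hK x).1 hx
    exact ⟨Submodule.Quotient.mk a, Subtype.ext (Submodule.liftQ_apply (LinearMap.ker f) f (h := le_rfl) a)⟩
  let e : (A ⧸ LinearMap.ker f) ≃+ K := AddEquiv.ofBijective g' hg'
  have he : ∀ (r : IwasawaAlgebra p) (q : A ⧸ LinearMap.ker f), e (r • q) = θ r • e q := fun r q ↦
    Subtype.ext (g.map_smulₛₗ r q)
  rw [← TwoAdicKatoDeterminant.lengthAt_eq_of_semilinear_ringEquiv_of_asIdeal_eq_augIdealP θ e he 𝔓 h𝔓]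
  exact Module.lengthAt_quotient_le (LinearMap.ker f) 𝔓

end Semilinear

/-! ## §2 Per datum: the span-free `μ`-doors with a `θ`-SEMILINEAR column map -/

section PerDatum

variable {W : WeierstrassCurve ℚ} [W.IsElliptic] [W.IsGloballyMinimal]
  {κ : ZpExtension ℚ 2} {γ : absoluteGaloisGroup ℚ}
  {D : W.SelmerDualData κ γ} {Y : W.FineSelmerDualData κ γ}

omit [W.IsGloballyMinimal] in
/-- **THE `μ`-DOOR WITH SLACK, SEMILINEAR (KERNEL; span-free, image-free).** For the cyclotomic `(κ, γ)`, a Selmer dual datum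
`D` (`X = X(E/ℚ_∞)`) and a fine Selmer dual datum `Y` (`X₀`): a ring automorphism `θ` of `Λ`, an ideal `P ⊆ Λ`, `M ⊆ P`, a
`θ`-SEMILINEAR `τ : P → X` killing `M`, `π : X ↠ X₀` exact after `τ`, `G ≠ 0` and `s ∉ (2)` with `s·G ∈ M`; if `Sel₀(ℚ_∞, E[2^∞])[2]`
is finite then `μ(X) ≤ μ(G)`. Proof: `length_(2)(P/M) ≤ length_(2)(Λ/(s·G)) = μ(G)` (as in p694319), `ker π = τ(P/M)` is the range
of a `θ`-semilinear map so `length_(2) ker π ≤ length_(2)(P/M)` (§1), `length_(2) X₀ = 0`, `length_(2) X ≤ length_(2) ker π +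
length_(2) X₀`. `θ = 1` is GEN 3's `mu_le_mu_of_unitMultiple_of_exact_of_finite_fineSelmer_pTorsion`.
[cite: Kato2004Asterisque, §17.13 (pp. 279–280) (shape of the sequence)] [cite: GreenbergLNM1716, §1 p. 60 (the two Λ-structures on a dual)]
[cite: Washington1997, §13.2] -/
theorem mu_le_mu_of_unitMultiple_of_exact_semilinear_of_finite_fineSelmer_pTorsion (hκ : κ.IsCyclotomic)
    (hγ : κ.IsTopGenerator γ) {G : IwasawaAlgebra 2} (hG : G ≠ 0)
    (θ : IwasawaAlgebra 2 ≃+* IwasawaAlgebra 2)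
    (P : Submodule (IwasawaAlgebra 2) (IwasawaAlgebra 2)) (M : Submodule (IwasawaAlgebra 2) P)
    (τ : P →ₛₗ[(θ : IwasawaAlgebra 2 →+* IwasawaAlgebra 2)] D.X) (π : D.X →ₗ[IwasawaAlgebra 2] Y.X)
    (hτM : ∀ m ∈ M, τ m = 0) (hπs : Function.Surjective π) (hπ : Function.Exact τ π)
    (himg : ∃ s : IwasawaAlgebra 2, s ∉ IwasawaAlgebra.augIdealP 2 ∧ s * G ∈ Submodule.map P.subtype M)
    (hfin : Set.Finite {s : W.fineSelmerInfty κ | 2 • s = 0}) : D.mu ≤ mu G := by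
  -- `X(E/ℚ_∞)` is finitely generated over `Λ` for the cyclotomic `κ` (PROVED in the tree, Nakayama)
  haveI : Module.Finite (IwasawaAlgebra 2) D.X :=
    WeierstrassCurve.SelmerDualData.module_finite_of_isCyclotomic W κ hκ D hγ
  haveI : Module.Finite (IwasawaAlgebra 2) Y.X := Module.Finite.of_surjective π hπs
  obtain ⟨s, hs, hsGM⟩ := himg
  have hs0 : s ≠ 0 := by rintro rfl; exact hs (Submodule.zero_mem _)
  -- `Sel₀(E/ℚ_∞)[2]` finite (displayed) ⇒ `X₀/2X₀` finite
  haveI : Finite (Y.X ⧸ (IwasawaAlgebra.augIdealP 2 • (⊤ : Submodule (IwasawaAlgebra 2) Y.X))) :=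
    Y.finite_quotient_augIdealP_of_finite_pTorsion hfin
  let 𝔭 : PrimeSpectrum (IwasawaAlgebra 2) :=
    ⟨IwasawaAlgebra.augIdealP 2, IwasawaAlgebra.isPrime_augIdealP_holds 2⟩
  have hY0 : Module.lengthAt (IwasawaAlgebra 2) Y.X 𝔭 = 0 :=
    KatoMuSkeleton.lengthAt_eq_zero_of_finite_quotient_p (M := Y.X) 𝔭 rfl
  -- `length_(2)(Λ/(s·G)) = μ(G)`
  have hsG : Module.lengthAt (IwasawaAlgebra 2) (IwasawaAlgebra 2 ⧸ Ideal.span {s * G}) 𝔭 = mu G := by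
    rw [Module.lengthAt_quotient_span_singleton_mul G hs0 𝔭,
      Module.lengthAt_quotient_eq_zero_of_not_le (I := Ideal.span {s})
        (by rwa [Ideal.span_singleton_le_iff_mem]), zero_add,
      lengthAt_augIdealP_quotient_span_singleton_eq_mu hG 𝔭 rfl]
  have hX : Module.lengthAt (IwasawaAlgebra 2) D.X 𝔭 ≤ mu G := by
    set M' : Ideal (IwasawaAlgebra 2) := Submodule.map P.subtype M with hM'
    -- `Λ/(s·G) ↠ Λ/M'`
    have hspan : Ideal.span {s * G} ≤ M' := by
      rw [Ideal.span_singleton_le_iff_mem]; exact hsGM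
    have hΛM : Module.lengthAt (IwasawaAlgebra 2) (IwasawaAlgebra 2 ⧸ M') 𝔭 ≤ mu G := by
      rw [← hsG]
      exact Module.lengthAt_le_of_surjective (Submodule.factor hspan) (Submodule.factor_surjective hspan) 𝔭
    -- `P/M ↪ Λ/M'`
    have hPM : Module.lengthAt (IwasawaAlgebra 2) (P ⧸ M) 𝔭 ≤ mu G := by
      refine le_trans ?_ hΛM
      refine Module.lengthAt_le_of_injective (Submodule.mapQ M M' P.subtype fun y hy => ⟨y, hy, rfl⟩) ?_ 𝔭
      rw [← LinearMap.ker_eq_bot, Submodule.ker_mapQ, hM',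
        Submodule.comap_map_eq_of_injective P.injective_subtype, Submodule.mkQ_map_self]
    -- semilinear step: `ker π = τ(P ⧸ M)` is the range of a `θ`-semilinear map out of `P ⧸ M`
    have hle : M ≤ LinearMap.ker τ := fun m hm => hτM m hm
    let f' : (P ⧸ M) →ₛₗ[(θ : IwasawaAlgebra 2 →+* IwasawaAlgebra 2)] D.X := M.liftQ τ hle
    have hK : ∀ x, x ∈ LinearMap.ker π ↔ x ∈ Set.range f' := by
      intro x
      rw [LinearMap.mem_ker]
      constructor
      · intro hx
        obtain ⟨u, rfl⟩ := (hπ x).1 hx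
        exact ⟨Submodule.Quotient.mk u, Submodule.liftQ_apply _ _ u⟩
      · rintro ⟨q, rfl⟩
        obtain ⟨u, rfl⟩ := Submodule.mkQ_surjective M q
        exact (hπ _).2 ⟨u, (Submodule.liftQ_apply _ _ u).symm⟩
    have hker : Module.lengthAt (IwasawaAlgebra 2) (LinearMap.ker π) 𝔭 ≤ mu G :=
      (lengthAt_le_of_range_semilinear θ f' (LinearMap.ker π) hK 𝔭 rfl).trans hPM
    calc Module.lengthAt (IwasawaAlgebra 2) D.X 𝔭
        ≤ Module.lengthAt (IwasawaAlgebra 2) (LinearMap.ker π) 𝔭 +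
            Module.lengthAt (IwasawaAlgebra 2) Y.X 𝔭 :=
          Module.lengthAt_le_add_of_exact (LinearMap.ker π).subtype π (LinearMap.exact_subtype_ker_map π) 𝔭
      _ ≤ mu G := by rw [hY0, add_zero]; exact hker
  change muInvariant 2 D.X ≤ mu G
  rw [muInvariant_eq_toNat_lengthAt 2 D.X 𝔭 rfl]
  exact_mod_cast (ENat.coe_toNat_le_self _).trans hX

omit [W.IsGloballyMinimal] in
/-- **THE `μ = 0` DOOR, SEMILINEAR (KERNEL; span-free, image-free)** — the `G₁ ∉ (2)` case of the slack door: `θ : Λ ≃+* Λ`,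
ideal `P`, `M ⊆ P`, a `θ`-semilinear `τ : P → X` killing `M`, `π : X ↠ X₀` exact after `τ`, `s·G₁ ∈ M` with `s, G₁ ∉ (2)`, and
`Sel₀(E/ℚ_∞)[2]` finite ⇒ `μ(X) = 0` (`μ(G₁) = 0` for `G₁ ∉ (2)`, `X1.MuLambda.mu_eq_and_pfree_eq`). `θ = 1` is GEN 3's
`mu_eq_zero_of_unitMultiple_of_exact_of_finite_fineSelmer_pTorsion` (p693670). [cite: Kato2004Asterisque, §17.13 (pp. 279–280)]
[cite: GreenbergLNM1716, §1 p. 60 (after Conj. 1.3)] -/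
theorem mu_eq_zero_of_unitMultiple_of_exact_semilinear_of_finite_fineSelmer_pTorsion (hκ : κ.IsCyclotomic)
    (hγ : κ.IsTopGenerator γ) {G₁ : IwasawaAlgebra 2} (hμL : G₁ ∉ IwasawaAlgebra.augIdealP 2)
    (θ : IwasawaAlgebra 2 ≃+* IwasawaAlgebra 2)
    (P : Submodule (IwasawaAlgebra 2) (IwasawaAlgebra 2)) (M : Submodule (IwasawaAlgebra 2) P)
    (τ : P →ₛₗ[(θ : IwasawaAlgebra 2 →+* IwasawaAlgebra 2)] D.X) (π : D.X →ₗ[IwasawaAlgebra 2] Y.X)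
    (hτM : ∀ m ∈ M, τ m = 0) (hπs : Function.Surjective π) (hπ : Function.Exact τ π)
    (himg : ∃ s : IwasawaAlgebra 2, s ∉ IwasawaAlgebra.augIdealP 2 ∧ s * G₁ ∈ Submodule.map P.subtype M)
    (hfin : Set.Finite {s : W.fineSelmerInfty κ | 2 • s = 0}) : D.mu = 0 := by
  have hG0 : G₁ ≠ 0 := by rintro rfl; exact hμL (Submodule.zero_mem _)
  -- `μ(G₁) = 0` since `2 ∤ G₁`
  have hred : red G₁ ≠ 0 := by
    intro h
    rw [red_eq_zero_iff] at h
    exact hμL (by rw [IwasawaAlgebra.augIdealP, Ideal.mem_span_singleton]; exact h)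
  have hmu : mu G₁ = 0 := (mu_eq_and_pfree_eq (a := 0) hred (by simp)).1
  have h := mu_le_mu_of_unitMultiple_of_exact_semilinear_of_finite_fineSelmer_pTorsion hκ hγ hG0 θ P M τ π hτM hπs
    hπ himg hfin
  omega

end PerDatum

/-! ## §3 Kato's `μ`-part at ONE curve from the semilinear package -/

/-- **`X5.O1.KatoMuPartAtTwo W′` at ONE curve — ANY image of `ρ̄₂` — from the SEMILINEAR span-free Coleman package** for every
newform of `W′`, all cyclotomic data and all dual data (`∃ θ P M τ π`, `τ : P →ₛₗ[θ] X`), «`Sel₀(W′/ℚ_∞)[2]` finite» for every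
cyclotomic `κ`, and «`0 ≤ ord₂ ϖ`» for every newform/Néron ratio of `W′`: `L₀ = ϖ₀·G` (INT2-AUTO `G`, `ι` injective, `ϖ₀ ∈ ℤ₂`)
and `2^{μ(X)} ∣ 2^{μ(G)} ∣ G ∣ L₀` (§2). GEN 3's p694319 §3 re-keyed; all inputs displayed; conditional; nothing asserted.
[cite: GreenbergLNM1716, §1 p. 60, p. 170 (shape)] [cite: Kato2004Asterisque, §17.13 (pp. 279–280)] [cite: MazurTateTeitelbaum1986Invent, §I.12] -/
theorem katoMuPartAtTwo_of_colemanPackageSemilinear_of_finite_fineSelmer_of_integralRatio (W' : WeierstrassCurve ℚ)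
    [W'.IsElliptic] [W'.IsGloballyMinimal]
    (hC : ∀ {N : ℕ} [NeZero N] (f : CuspForm (Gamma0 N) 2) (κ : ZpExtension ℚ 2) (γ : absoluteGaloisGroup ℚ),
      κ.IsCyclotomic → κ.IsTopGenerator γ → IsCyclotomicVariable 2 γ → IsNewformOf W' f →
      ∀ (D : W'.SelmerDualData κ γ) (Y : W'.FineSelmerDualData κ γ),
        ∃ (θ : IwasawaAlgebra 2 ≃+* IwasawaAlgebra 2) (P : Submodule (IwasawaAlgebra 2) (IwasawaAlgebra 2))
          (M : Submodule (IwasawaAlgebra 2) P)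
          (τ : P →ₛₗ[(θ : IwasawaAlgebra 2 →+* IwasawaAlgebra 2)] D.X) (π : D.X →ₗ[IwasawaAlgebra 2] Y.X),
          (∀ m ∈ M, τ m = 0) ∧ Function.Surjective π ∧ Function.Exact τ π ∧
          ∀ G₁ : IwasawaAlgebra 2, iwasawaToPowerSeries 2 G₁ = padicLFunction f (unitRoot W' 2 : ℚ_[2]) →
            ∃ s : IwasawaAlgebra 2, s ∉ IwasawaAlgebra.augIdealP 2 ∧ s * G₁ ∈ Submodule.map P.subtype M)
    (hA : ∀ κ : ZpExtension ℚ 2, κ.IsCyclotomic → Set.Finite {s : W'.fineSelmerInfty κ | 2 • s = 0})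
    (hϖ : ∀ {N : ℕ} [NeZero N] (f : CuspForm (Gamma0 N) 2), IsNewformOf W' f →
      ∀ ϖ : ℚ, (ϖ : ℝ) * W'.realPeriodRat = plusPeriod f → 0 ≤ padicValRat 2 ϖ) :
    O1.KatoMuPartAtTwo W' := by
  intro κ γ hκ hγ hγ' hord _ f hf ϖ hϖf D L₀ hL₀
  obtain ⟨Y⟩ := W'.nonempty_fineSelmerDualData κ hγ
  obtain ⟨θ, P, M, τ, π, hτM, hπs, hπ, himg⟩ := hC f κ γ hκ hγ hγ' hf D Y
  -- `L₂(f, α) = ι G` (INT2-AUTO) and `L₀ = ϖ₀ · G`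
  obtain ⟨G, hG⟩ := exists_iwasawaToPowerSeries_eq_padicLFunction_two_auto (W := W') (f := f) hord hf
  have hnorm : ‖((ϖ : ℚ) : ℚ_[2])‖ ≤ 1 := by
    by_cases h0 : ϖ = 0
    · subst h0; simp
    have hϖQ : ((ϖ : ℚ) : ℚ_[2]) ≠ 0 := by exact_mod_cast h0
    rw [Padic.norm_eq_zpow_neg_valuation hϖQ, Padic.valuation_ratCast]
    exact zpow_le_one_of_nonpos₀ (by norm_num) (by linarith [hϖ f hf ϖ hϖf])
  let ϖ₀ : ℤ_[2] := ⟨((ϖ : ℚ) : ℚ_[2]), hnorm⟩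
  have hL₀G : L₀ = (PowerSeries.C ϖ₀ : IwasawaAlgebra 2) * G := by
    apply iwasawaToPowerSeries_injective 2
    rw [hL₀, map_mul, hG, iwasawaToPowerSeries, PowerSeries.map_C]
    rfl
  by_cases hG0 : G = 0
  · rw [hL₀G, hG0, mul_zero]; exact dvd_zero _
  -- `μ(X) ≤ μ(G)` and `2^{μ(X)} ∣ 2^{μ(G)} ∣ G ∣ L₀`
  have hμ : D.mu ≤ mu G :=
    mu_le_mu_of_unitMultiple_of_exact_semilinear_of_finite_fineSelmer_pTorsion hκ hγ hG0 θ P M τ π hτM hπs hπ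
      (himg G hG) (hA κ hκ)
  calc (PowerSeries.C (((2 : ℕ) : ℤ_[2]) ^ D.mu) : IwasawaAlgebra 2)
      ∣ PowerSeries.C (((2 : ℕ) : ℤ_[2]) ^ mu G) := map_dvd _ (pow_dvd_pow _ hμ)
    _ ∣ G := C_pow_mu_dvd hG0
    _ ∣ L₀ := by rw [hL₀G]; exact dvd_mul_left _ _

/-- **`X5.O1.KatoMuPartAtTwo W` at ONE curve with `E[2]` IRREDUCIBLE (image `S₃` or `C₃`, any sign of `Δ`) from the SEMILINEAR
span-free package for all cyclotomic data of `W` and «`Sel₀(W/ℚ_∞)[2]` finite»** — no Néron ratio needed: analytic `μ₂ = 0`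
(`AnalyticMuTwo.exists_norm_padicLCoeff_two_eq_one`, p642753) gives `G₁ ∉ (2)`, then §2 gives `μ = 0` and `2^0 ∣ L₀`. GEN 3's p693670
§2 re-keyed. [cite: GreenbergLNM1716, §1 p. 60, Conj. 1.11 (shape)] [cite: Kato2004Asterisque, §17.13 (pp. 279–280)]
[cite: MazurTateTeitelbaum1986Invent, §I.12] -/
theorem katoMuPartAtTwo_of_colemanPackageSemilinear_of_finite_fineSelmer_irr (W : WeierstrassCurve ℚ) [W.IsElliptic]
    [W.IsGloballyMinimal] (hirr : W.HasIrreducibleModPGaloisRep 2)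
    (hCW : ∀ {N : ℕ} [NeZero N] (f : CuspForm (Gamma0 N) 2) (κ : ZpExtension ℚ 2) (γ : absoluteGaloisGroup ℚ),
      κ.IsCyclotomic → κ.IsTopGenerator γ → IsCyclotomicVariable 2 γ → IsNewformOf W f →
      ∀ (D : W.SelmerDualData κ γ) (Y : W.FineSelmerDualData κ γ),
        ∃ (θ : IwasawaAlgebra 2 ≃+* IwasawaAlgebra 2) (P : Submodule (IwasawaAlgebra 2) (IwasawaAlgebra 2))
          (M : Submodule (IwasawaAlgebra 2) P)
          (τ : P →ₛₗ[(θ : IwasawaAlgebra 2 →+* IwasawaAlgebra 2)] D.X) (π : D.X →ₗ[IwasawaAlgebra 2] Y.X),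
          (∀ m ∈ M, τ m = 0) ∧ Function.Surjective π ∧ Function.Exact τ π ∧
          ∀ G₁ : IwasawaAlgebra 2, iwasawaToPowerSeries 2 G₁ = padicLFunction f (unitRoot W 2 : ℚ_[2]) →
            ∃ s : IwasawaAlgebra 2, s ∉ IwasawaAlgebra.augIdealP 2 ∧ s * G₁ ∈ Submodule.map P.subtype M)
    (hAW : ∀ κ : ZpExtension ℚ 2, κ.IsCyclotomic → Set.Finite {s : W.fineSelmerInfty κ | 2 • s = 0}) :
    O1.KatoMuPartAtTwo W := by
  intro κ γ hκ hγ hγ' hord _ f hf ϖ _ D L₀ _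
  obtain ⟨Y⟩ := W.nonempty_fineSelmerDualData κ hγ
  obtain ⟨θ, P, M, τ, π, hτM, hπs, hπ, himg⟩ := hCW f κ γ hκ hγ hγ' hf D Y
  -- `L₂(f, α) ∈ ι(Λ)` (INT2-AUTO) and analytic `μ₂ = 0` for `E[2]` irreducible: `G₁ ∉ (2)`
  obtain ⟨G₁, hG₁⟩ := exists_iwasawaToPowerSeries_eq_padicLFunction_two_auto (W := W) (f := f) hord hf
  obtain ⟨k, hk⟩ := AnalyticMuTwo.exists_norm_padicLCoeff_two_eq_one W hord hirr hf
  have hμL : G₁ ∉ IwasawaAlgebra.augIdealP 2 :=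
    not_mem_augIdealP_of_norm_coeff_eq_one hG₁ ⟨k, by rw [coeff_padicLFunction]; exact hk⟩
  rw [mu_eq_zero_of_unitMultiple_of_exact_semilinear_of_finite_fineSelmer_pTorsion hκ hγ hμL θ P M τ π hτM hπs hπ
    (himg G₁ hG₁) (hAW κ hκ), pow_zero, map_one]
  exact one_dvd _

/-! ## §4 «`ρ̄_{W,2}` not onto» along the isogeny class, and statement (A₂) at every member -/

/-- **«`ρ̄_{W,2}` NOT onto» is a property of the `ℚ`-isogeny class** (GEN 3's «optional odd-degree transport»): if `E[2]` is
irreducible, surjectivity of `ρ̄₂` is constant on the class (`GaloisImage.surj_iff_of_isIsogenous_of_irr`: an isogeny not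
killing `E[2]` restricts to a `Γ_ℚ`-isomorphism `E[2] ≃ E₀[2]`); if `E[2]` is reducible, so is `E₀[2]`
(`Rank1Residual.not_hasIrreducibleModPGaloisRep_of_isIsogenous`) and a surjective `ρ̄₂` would be irreducible (Serre §4). [cite: Serre1972, §4] -/
theorem not_hasSurjectiveModNGaloisRep_two_of_isIsogenous (W : WeierstrassCurve ℚ) [W.IsElliptic]
    (hns : ¬ W.HasSurjectiveModNGaloisRep 2) {W₀ : WeierstrassCurve ℚ} [W₀.IsElliptic]
    (hiso : WeierstrassCurve.IsIsogenous W W₀) : ¬ W₀.HasSurjectiveModNGaloisRep 2 := by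
  by_cases hirr : W.HasIrreducibleModPGaloisRep 2
  · intro hs
    exact hns ((GaloisImage.surj_iff_of_isIsogenous_of_irr (p := 2) hiso hirr).mpr hs)
  · exact not_hasSurjectiveModNGaloisRep_two_of_isIsogenous_of_not_irreducible W hirr hiso

/-- **Statement (A₂) — «`Sel₀(W₀/ℚ_∞, E[2^∞])[2]` finite» — at EVERY isogenous member `W₀` of a curve with `ρ̄_{W,2}` NOT onto,
from Lim 2017 Thm 3.5 at `2` and Ferrero–Washington BY NAME** (GEN 3's p695632 at `W₀`, which is not onto by the transport above).
[cite: Lim2017FineSelmer, §3 Thm. 3.5 and Lemma 3.2] [cite: FerreroWashington1979, main theorem] -/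
theorem conjATwo_notSurjective_isogenous
    (hLim2 : Lim2017.thm35_at_two_fineSelmerDual_moduleFinite_of_classicalMuVanishes_of_le_divisionField_four)
    (hFW : ferreroWashington1979_classicalMuVanishes) (W : WeierstrassCurve ℚ) [W.IsElliptic]
    (hns : ¬ W.HasSurjectiveModNGaloisRep 2) {W₀ : WeierstrassCurve ℚ} [W₀.IsElliptic]
    (hiso : WeierstrassCurve.IsIsogenous W W₀) (κ : ZpExtension ℚ 2) (hκ : κ.IsCyclotomic) :
    Set.Finite {s : W₀.fineSelmerInfty κ | 2 • s = 0} :=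
  finite_fineSelmerInfty_twoTorsion_of_not_hasSurjectiveModNGaloisRep hLim2 hFW W₀
    (not_hasSurjectiveModNGaloisRep_two_of_isIsogenous W hns hiso) κ hκ

/-! ## §5 B7′ BY NAME from PRINT + ONE semilinear Coleman package at the optimal member, uniformly in the image -/

/-- **B7′ `KatoMuPartOff514AtOptimalMemberOfNotSurjectiveTwo` (child stmt-BirchSwinnertonDyer-23921) BY NAME ⟸ FOUR PRINT FACTS
(Abbes–Ullmo, modularity, Lim 2017 Thm 3.5 at `2`, Ferrero–Washington) + ONE displayed binder, UNIFORM IN THE IMAGE**: (Col½-opt)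
`hC` — for every non-CM globally minimal `W`, good ordinary at `2`, `ρ̄_{W,2}` NOT onto, every isogenous lattice-optimal `W₀`
(datum `D₀`, `Λ_{W₀} = c₀·Λ_f`), every newform of `W₀`, all cyclotomic and dual data: the SEMILINEAR span-free Coleman package
(`∃ θ P M τ π`: ideal `P ⊆ Λ` = Coleman image (Prop. 17.11), `M ⊆ P` the Coleman coordinates of the global (zeta / HALF)
classes (Thm. 16.6; on `0 < Δ` the half classes, F-27a), `τ : P →ₛₗ[θ] X` the Poitou–Tate column map killing `M` with image
`ker(X ↠ X₀)`, `s·G₁ ∈ M` with `s ∉ (2)` for every integral lift `G₁` of `L₂(f, α)`; a READING of Kato §§12–17 at `2`, memo tier,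
nothing asserted). Assembly: witness = the optimal member (p692385 `katoMuPartOff514_of_optimalMember`, left disjunct); its
`μ`-part by §3 with (A₂) := `conjATwo_notSurjective_isogenous` (§4) and `ord₂ ϖ = 0` at `W₀` (p692385, Abbes–Ullmo). Compared with
GEN 3's p696823: ONE binder instead of two (no `C₃`/reducible split) and the honest keying. Conditional; nothing closed.
[cite: AbbesUllmo1996, Thm. A] [cite: EdixhovenManin1991, Prop. 2] [cite: Lim2017FineSelmer, §3 Thm. 3.5 and Lemma 3.2]
[cite: FerreroWashington1979, main theorem] [cite: Kato2004Asterisque, Thm. 16.6 (p. 271), Prop. 17.11 (p. 277), §17.13 (pp. 279–280) (shape; nothing asserted)] -/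
theorem katoMuPartOff514_of_print_of_colemanPackageSemilinear_optimal
    (hAU : abbesUllmo_not_dvd_maninConstant_of_not_dvd_level) (hMod : nonempty_modularParametrizationData)
    (hLim2 : Lim2017.thm35_at_two_fineSelmerDual_moduleFinite_of_classicalMuVanishes_of_le_divisionField_four)
    (hFW : ferreroWashington1979_classicalMuVanishes)
    (hC : ∀ (W : WeierstrassCurve ℚ) [W.IsElliptic] [W.IsGloballyMinimal],
      ¬ W.HasCM → GoodOrd W 2 → ¬ W.HasSurjectiveModNGaloisRep 2 →
      ∀ (W₀ : WeierstrassCurve ℚ) [W₀.IsElliptic] [W₀.IsGloballyMinimal] {N₀ : ℕ} [NeZero N₀]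
        (D₀ : ModularParametrizationData W₀ N₀), WeierstrassCurve.IsIsogenous W W₀ →
        (∀ z ∈ D₀.L.lattice, ∃ w ∈ periodLattice D₀.f, z = D₀.c * w) →
      ∀ {N : ℕ} [NeZero N] (f : CuspForm (Gamma0 N) 2) (κ : ZpExtension ℚ 2) (γ : absoluteGaloisGroup ℚ),
        κ.IsCyclotomic → κ.IsTopGenerator γ → IsCyclotomicVariable 2 γ → IsNewformOf W₀ f →
        ∀ (D : W₀.SelmerDualData κ γ) (Y : W₀.FineSelmerDualData κ γ),
          ∃ (θ : IwasawaAlgebra 2 ≃+* IwasawaAlgebra 2) (P : Submodule (IwasawaAlgebra 2) (IwasawaAlgebra 2))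
            (M : Submodule (IwasawaAlgebra 2) P)
            (τ : P →ₛₗ[(θ : IwasawaAlgebra 2 →+* IwasawaAlgebra 2)] D.X) (π : D.X →ₗ[IwasawaAlgebra 2] Y.X),
            (∀ m ∈ M, τ m = 0) ∧ Function.Surjective π ∧ Function.Exact τ π ∧
            ∀ G₁ : IwasawaAlgebra 2, iwasawaToPowerSeries 2 G₁ = padicLFunction f (unitRoot W₀ 2 : ℚ_[2]) →
              ∃ s : IwasawaAlgebra 2, s ∉ IwasawaAlgebra.augIdealP 2 ∧ s * G₁ ∈ Submodule.map P.subtype M) :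
    KatoMuPartOff514AtOptimalMemberOfNotSurjectiveTwo := by
  refine katoMuPartOff514_of_optimalMember hAU hMod ?_
  intro W _ _ hcm hgo hns W₀ _ _ N₀ _ D₀ hiso hopt
  exact Or.inl <| katoMuPartAtTwo_of_colemanPackageSemilinear_of_finite_fineSelmer_of_integralRatio W₀
    (fun f κ γ hκ hγ hγ' hf D Y ↦ hC W hcm hgo hns W₀ D₀ hiso hopt f κ γ hκ hγ hγ' hf D Y)
    (fun κ hκ ↦ conjATwo_notSurjective_isogenous hLim2 hFW W hns hiso κ hκ)
    (fun f hf ϖ hϖ ↦ (padicValRat_two_neronRatio_eq_zero_of_latticeOptimal_of_abbesUllmo hAU W₀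
      (goodOrd_two_of_isIsogenous W hiso hgo).1 D₀ hopt f hf ϖ hϖ).ge)

/-- **The route's child `OrdKatoMuPartOptimalAtTwo` (stmt-BirchSwinnertonDyer-23921, text = B7′ verbatim) BY NAME from the four
print facts and the ONE semilinear Coleman binder at the optimal member.** Conditional; the item is NOT closed by this; nothing
asserted. [cite: AbbesUllmo1996, Thm. A] [cite: Lim2017FineSelmer, §3 Thm. 3.5 and Lemma 3.2] [cite: FerreroWashington1979, main theorem] -/
theorem ordKatoMuPartOptimalAtTwo_of_print_of_colemanPackageSemilinear_optimal
    (hAU : abbesUllmo_not_dvd_maninConstant_of_not_dvd_level) (hMod : nonempty_modularParametrizationData)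
    (hLim2 : Lim2017.thm35_at_two_fineSelmerDual_moduleFinite_of_classicalMuVanishes_of_le_divisionField_four)
    (hFW : ferreroWashington1979_classicalMuVanishes)
    (hC : ∀ (W : WeierstrassCurve ℚ) [W.IsElliptic] [W.IsGloballyMinimal],
      ¬ W.HasCM → GoodOrd W 2 → ¬ W.HasSurjectiveModNGaloisRep 2 →
      ∀ (W₀ : WeierstrassCurve ℚ) [W₀.IsElliptic] [W₀.IsGloballyMinimal] {N₀ : ℕ} [NeZero N₀]
        (D₀ : ModularParametrizationData W₀ N₀), WeierstrassCurve.IsIsogenous W W₀ →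
        (∀ z ∈ D₀.L.lattice, ∃ w ∈ periodLattice D₀.f, z = D₀.c * w) →
      ∀ {N : ℕ} [NeZero N] (f : CuspForm (Gamma0 N) 2) (κ : ZpExtension ℚ 2) (γ : absoluteGaloisGroup ℚ),
        κ.IsCyclotomic → κ.IsTopGenerator γ → IsCyclotomicVariable 2 γ → IsNewformOf W₀ f →
        ∀ (D : W₀.SelmerDualData κ γ) (Y : W₀.FineSelmerDualData κ γ),
          ∃ (θ : IwasawaAlgebra 2 ≃+* IwasawaAlgebra 2) (P : Submodule (IwasawaAlgebra 2) (IwasawaAlgebra 2))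
            (M : Submodule (IwasawaAlgebra 2) P)
            (τ : P →ₛₗ[(θ : IwasawaAlgebra 2 →+* IwasawaAlgebra 2)] D.X) (π : D.X →ₗ[IwasawaAlgebra 2] Y.X),
            (∀ m ∈ M, τ m = 0) ∧ Function.Surjective π ∧ Function.Exact τ π ∧
            ∀ G₁ : IwasawaAlgebra 2, iwasawaToPowerSeries 2 G₁ = padicLFunction f (unitRoot W₀ 2 : ℚ_[2]) →
              ∃ s : IwasawaAlgebra 2, s ∉ IwasawaAlgebra.augIdealP 2 ∧ s * G₁ ∈ Submodule.map P.subtype M) :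
    OrdKatoMuPartOptimalAtTwo :=
  katoMuPartOff514_of_print_of_colemanPackageSemilinear_optimal hAU hMod hLim2 hFW hC

end Summit.BirchSwinnertonDyer.BirchSwinnertonDyer.Theorems.SteinbergFibreAtTwo

end
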